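import Summits.AtomisticToContinuum.BoseEinsteinCondensation.Theses.BECProbeMassFlow
import Summits.AtomisticToContinuum.BoseEinsteinCondensation.Theorems.BECProbeMassFlowCloudMomentumAtomFreeZeroMomentum
import Summits.AtomisticToContinuum.BoseEinsteinCondensation.Theorems.BECInsertionCorrectorStaticResponseBoundSectorDecompositionFibre
import Summits.AtomisticToContinuum.BoseEinsteinCondensation.Theorems.BECInsertionCorrectorStaticResponseBoundSectorDecompositionMeasure
import HarnessLib

/-!
# Projection transfer on the torus — stub `stub_projectionTransfer`

Helper file for the crux `BECProbeMassFlow.CloudMomentumAtom` (item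
stmt-AtomisticToContinuum-12310), line `registered` (skeleton `Cruxes/CloudMomentumAtom/Lines/birth.lean`):
the registered stub **`stub_projectionTransfer`**, statement verbatim from the checked skeleton.

For `L > 0`, `ε > 0` and two periodic trial states `Φ, Ψ` of `N` bosons on the torus of side `L`:
if `|⟨Ψ, Φ⟩|² ≥ 1 − ε/2` and `L⁶ w₀(Ψ) ≥ (1 − ε²/16) L⁶` then `L⁶ w₀(Φ) ≥ (1 − ε) L⁶`, where
`L⁶ w₀(Φ) = ∫⁻_{cell^N} ‖∫_{cell} Φ(X + t𝟙) dt‖₊² = L⁶ ‖PΦ‖²` and `P = L⁻³ ∫_{cell} T_t dt`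
(`WF.comProj`) is the projection onto total momentum `0`.

## Proof (deterministic Hilbert-space geometry in `L²(cell^N)`)

All states are normalised. With `⟨f, g⟩ = ∫_{cell^N} conj f · g`:

* `⟨PΨ, Φ⟩ = ⟨PΨ, PΦ⟩` (`inner_comProj_eq_of_invariant`): a translation-invariant periodic `F`
  pairs with `G` exactly as with `PG` — Fubini over `cell^N × cell` and the cell shift
  `X ↦ X + s𝟙` (`secdec_setIntegral_fibre_average` applied to the bounded continuous periodic
  `conj F · G`);
* Cauchy–Schwarz on the cell (`nnnorm_inner_sq_le_normSq_mul`, Hölder `p = q = 2`) and Pythagoras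
  `‖Ψ‖² = ‖PΨ‖² + ‖Ψ − PΨ‖²` (`WF.comProj_pythagoras`): with `a = |⟨Ψ, Φ⟩|`,
  `b = |⟨PΨ, PΦ⟩|`, `c = |⟨Ψ − PΨ, Φ⟩|` one has `a ≤ b + c`, `a ≤ 1`, `b² ≤ ‖PΨ‖² ‖PΦ‖² ≤ ‖PΦ‖²`,
  `c² ≤ ‖Ψ − PΨ‖² = 1 − ‖PΨ‖² ≤ ε²/16`;
* numbers: for `ε ≥ 1` the claim is `ofReal (≤ 0) = 0 ≤ _`; for `ε < 1`,
  `a ≥ a² ≥ 1 − ε/2 > ε/4`, so `b ≥ a − ε/4 ≥ 0` and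
  `‖PΦ‖² ≥ b² ≥ a² − aε/2 + ε²/16 ≥ (1 − ε/2) − ε/2 = 1 − ε` (`a ≤ 1`);
* unscaling `∫⁻‖∫_{cell} Φ(X + t𝟙) dt‖₊² = L⁶ ‖PΦ‖²` (`normSq_comProj_eq`).

No new definitions; every declaration is a theorem.
-/

noncomputable section

open MeasureTheory Filter
open scoped ENNReal NNReal ComplexConjugate BigOperators

namespace Summit.AtomisticToContinuum.BoseEinsteinCondensation.Cruxes.CloudMomentumAtom.Birth

open Literature.MathematicalPhysics.QuantumManyBody.BoseGas
open Summit.AtomisticToContinuum.BoseEinsteinCondensation.Cruxes.PeriodicIRBound.LinearPhFloorWagner.WF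
open Summit.AtomisticToContinuum.BoseEinsteinCondensation.Cruxes.StaticResponseBound.StableFractionSquareCompletion
  (secdec_setIntegral_fibre_average secdec_exists_bound)

variable {N : ℕ} {L : ℝ}

/-! ### Cauchy–Schwarz for the cell pairing -/

/-- **Cauchy–Schwarz for the cell pairing**, `ℝ≥0∞` form: `‖∫_{cell^N} conj F · G‖₊² ≤ ‖F‖² ‖G‖²`
for measurable `F, G` (Hölder with `p = q = 2` for the lower Lebesgue integral,
`ENNReal.lintegral_mul_le_Lp_mul_Lq`). [folklore] -/
theorem nnnorm_inner_sq_le_normSq_mul {F G : Config N → ℂ} (hF : Measurable F) (hG : Measurable G) :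
    ((‖∫ X in cellN N L, conj (F X) * G X‖₊ : ℝ≥0∞)) ^ 2 ≤ normSq L F * normSq L G := by
  -- adapted from `enorm_integral_conj_mul_le` of `Literature/…/PeriodicBoseGasPairingMomentum.lean`
  have hH := ENNReal.lintegral_mul_le_Lp_mul_Lq (volume.restrict (cellN N L))
    Real.HolderConjugate.two_two hF.enorm.aemeasurable hG.enorm.aemeasurable
  have h1 : ((‖∫ X in cellN N L, conj (F X) * G X‖₊ : ℝ≥0∞)) ≤
      normSq L F ^ (1 / 2 : ℝ) * normSq L G ^ (1 / 2 : ℝ) :=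
    calc ((‖∫ X in cellN N L, conj (F X) * G X‖₊ : ℝ≥0∞))
        = ‖∫ X in cellN N L, conj (F X) * G X‖ₑ := (enorm_eq_nnnorm _).symm
      _ ≤ ∫⁻ X in cellN N L, ‖conj (F X) * G X‖ₑ := enorm_integral_le_lintegral_enorm _
      _ = ∫⁻ X in cellN N L, ‖F X‖ₑ * ‖G X‖ₑ := by simp_rw [enorm_mul, RCLike.enorm_conj]
      _ ≤ _ := by simpa only [normSq, Pi.mul_apply, ENNReal.rpow_two, enorm_eq_nnnorm] using hH
  have h2 : ∀ x : ℝ≥0∞, (x ^ (1 / 2 : ℝ)) ^ 2 = x := fun x => by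
    rw [← ENNReal.rpow_natCast, ← ENNReal.rpow_mul]
    norm_num
  calc ((‖∫ X in cellN N L, conj (F X) * G X‖₊ : ℝ≥0∞)) ^ 2
      ≤ (normSq L F ^ (1 / 2 : ℝ) * normSq L G ^ (1 / 2 : ℝ)) ^ 2 := by gcongr
    _ = normSq L F * normSq L G := by rw [mul_pow, h2, h2]

/-! ### A translation-invariant function pairs with `G` as with `PG` -/

/-- **`⟨F, PG⟩ = ⟨F, G⟩` for translation-invariant `F`.** For continuous `F, G` that are
`Lℤ³`-periodic in every particle, `F` invariant under the simultaneous translation of all particles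
and `L > 0`: `∫_{cell^N} conj F · PG = ∫_{cell^N} conj F · G`, `PG(X) = L⁻³ ∫_{cell} G(X + s𝟙) ds`
(`WF.comProj`). Proof: `conj F(X) · PG(X) = L⁻³ ∫_{cell} H(X + s𝟙) ds` with the bounded continuous
periodic `H = conj F · G` (invariance of `F`), and `∫_{cell^N} L⁻³∫_{cell} H(X + s𝟙) ds dX = ∫ H`
(Fubini and the cell shift, `secdec_setIntegral_fibre_average`). [folklore] -/
theorem inner_comProj_eq_of_invariant (hL : 0 < L) {F G : Config N → ℂ} (hF : Continuous F)
    (hFper : IsTorusPeriodic L F) (hFinv : ∀ (X : Config N) (s : Space), F (X + fun _ => s) = F X)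
    (hG : Continuous G) (hGper : IsTorusPeriodic L G) :
    ∫ X in cellN N L, conj (F X) * comProj L G X = ∫ X in cellN N L, conj (F X) * G X := by
  set H : Config N → ℂ := fun Y => conj (F Y) * G Y with hH
  have hHc : Continuous H := (Complex.continuous_conj.comp hF).mul hG
  have hHper : IsTorusPeriodic L H := fun X i k => by
    simp only [hH, hFper X i k, hGper X i k]
  obtain ⟨C, hC⟩ := secdec_exists_bound hL hHc hHper
  have hpt : ∀ X : Config N,
      conj (F X) * comProj L G X = ((L ^ 3)⁻¹ : ℝ) • ∫ s in cell L, H (X + fun _ => s) := by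
    intro X
    rw [comProj, mul_left_comm, ← integral_const_mul, ← Complex.real_smul]
    congr 1
    refine setIntegral_congr_fun (measurableSet_cell L) fun s _ => ?_
    show conj (F X) * G (X + fun _ => s) = conj (F (X + fun _ => s)) * G (X + fun _ => s)
    rw [hFinv]
  calc ∫ X in cellN N L, conj (F X) * comProj L G X
      = ∫ X in cellN N L, ((L ^ 3)⁻¹ : ℝ) • ∫ s in cell L, H (X + fun _ => s) :=
        integral_congr_ae (Eventually.of_forall hpt)
    _ = ∫ X in cellN N L, H X := secdec_setIntegral_fibre_average hL hHc hHper hC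

/-! ### The registered stub -/

/-- **Stub 3 `stub_projectionTransfer` — projection transfer** (statement verbatim from the checked
skeleton of the line `registered` of crux `CloudMomentumAtom`; deterministic Hilbert-space geometry
on the torus). For `L > 0`, `ε > 0` and any two periodic trial states `Φ, Ψ` of `N` bosons on the
torus of side `L`: if `|⟨Ψ, Φ⟩|² ≥ 1 − ε/2` and `L⁶ w₀(Ψ) ≥ (1 − ε²/16) L⁶` then
`L⁶ w₀(Φ) ≥ (1 − ε) L⁶`, where `L⁶ w₀(Φ) = ∫⁻_{cell^N} ‖∫_{cell} Φ(X + t𝟙) dt‖₊² = L⁶‖PΦ‖²`,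
`P = L⁻³∫_{cell} T_t dt` the orthogonal projection onto zero total momentum. Proof: with
`a = |⟨Ψ,Φ⟩|`, `b = |⟨PΨ, PΦ⟩| = |⟨PΨ, Φ⟩|`, `c = |⟨Ψ − PΨ, Φ⟩|`: `a ≤ b + c`, `a ≤ 1`,
`b² ≤ ‖PΦ‖²`, `c² ≤ ‖Ψ − PΨ‖² = 1 − ‖PΨ‖² ≤ ε²/16` (Cauchy–Schwarz, Pythagoras, the averaging
identity `⟨PΨ, Φ⟩ = ⟨PΨ, PΦ⟩`), whence for `ε < 1`:
`‖PΦ‖² ≥ (a − ε/4)² ≥ (1 − ε/2) − ε/2 = 1 − ε`; for `ε ≥ 1` the bound is `0 ≤ _`. [folklore] -/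
theorem stub_projectionTransfer :
    ∀ (N : ℕ) (L : ℝ), 0 < L → ∀ ε : ℝ, 0 < ε → ∀ Φ Ψ : PeriodicTrialState N L,
      ENNReal.ofReal (1 - ε / 2) ≤ (‖∫ X in cellN N L, conj (Ψ.ψ X) * Φ.ψ X‖₊ : ℝ≥0∞) ^ 2 →
      ENNReal.ofReal ((1 - ε ^ 2 / 16) * L ^ 6) ≤
        ∫⁻ X in cellN N L, (‖∫ t in cell L, Ψ.ψ (X + fun _ => t)‖₊ : ℝ≥0∞) ^ 2 →
      ENNReal.ofReal ((1 - ε) * L ^ 6) ≤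
        ∫⁻ X in cellN N L, (‖∫ t in cell L, Φ.ψ (X + fun _ => t)‖₊ : ℝ≥0∞) ^ 2 := by
  intro N L hL ε hε Φ Ψ h1 h2
  have hL6 : (0 : ℝ) < L ^ 6 := by positivity
  -- unscaling: the crux integrand is `L⁶ ‖Pf‖²`
  have hunscale : ∀ f : Config N → ℂ,
      ∫⁻ X in cellN N L, (‖∫ t in cell L, f (X + fun _ => t)‖₊ : ℝ≥0∞) ^ 2 =
        ENNReal.ofReal (L ^ 6) * normSq L (comProj L f) := fun f => by
    rw [normSq_comProj_eq hL, ← mul_assoc, ← ENNReal.ofReal_mul hL6.le, mul_inv_cancel₀ hL6.ne',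
      ENNReal.ofReal_one, one_mul]
  -- the degenerate case `ε ≥ 1`: the bound is `0 ≤ _`
  rcases le_or_gt 1 ε with hε1 | hε1
  · rw [ENNReal.ofReal_of_nonpos (mul_nonpos_of_nonpos_of_nonneg (by linarith) hL6.le)]
    exact bot_le
  -- cores, projections, Pythagoras
  have hΦc : IsCore L Φ.ψ := isCore_trialState Φ
  have hΨc : IsCore L Ψ.ψ := isCore_trialState Ψ
  obtain ⟨hPΨc, hPΨ0⟩ := isCore_comProj hL hΨc
  have hPΦc : IsCore L (comProj L Φ.ψ) := (isCore_comProj hL hΦc).1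
  have hPyΨ := (comProj_pythagoras (w := fun _ => 0) hL measurable_const hΨc).1
  have hPyΦ := (comProj_pythagoras (w := fun _ => 0) hL measurable_const hΦc).1
  rw [show normSq L Ψ.ψ = 1 from Ψ.norm_eq] at hPyΨ
  rw [show normSq L Φ.ψ = 1 from Φ.norm_eq] at hPyΦ
  set PΨ : Config N → ℂ := comProj L Ψ.ψ with hPΨdef
  set PΦ : Config N → ℂ := comProj L Φ.ψ with hPΦdef
  have hRΨc : IsCore L (fun X => Ψ.ψ X - PΨ X) := isCore_sub' hΨc hPΨc
  set RΨ : Config N → ℂ := fun X => Ψ.ψ X - PΨ X with hRΨdef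
  -- finiteness of the three masses (each is at most `1` by Pythagoras)
  have hpΨt : normSq L PΨ ≠ ⊤ :=
    ne_top_of_le_ne_top ENNReal.one_ne_top (le_self_add.trans_eq hPyΨ.symm)
  have hrΨt : normSq L RΨ ≠ ⊤ :=
    ne_top_of_le_ne_top ENNReal.one_ne_top (le_add_self.trans_eq hPyΨ.symm)
  have hpΦt : normSq L PΦ ≠ ⊤ :=
    ne_top_of_le_ne_top ENNReal.one_ne_top (le_self_add.trans_eq hPyΦ.symm)
  -- the three masses as real numbers
  obtain ⟨pΨ, hpΨ0, hpΨeq⟩ : ∃ p : ℝ, 0 ≤ p ∧ normSq L PΨ = ENNReal.ofReal p :=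
    ⟨_, ENNReal.toReal_nonneg, (ENNReal.ofReal_toReal hpΨt).symm⟩
  obtain ⟨rΨ, hrΨ0, hrΨeq⟩ : ∃ r : ℝ, 0 ≤ r ∧ normSq L RΨ = ENNReal.ofReal r :=
    ⟨_, ENNReal.toReal_nonneg, (ENNReal.ofReal_toReal hrΨt).symm⟩
  obtain ⟨pΦ, hpΦ0, hpΦeq⟩ : ∃ p : ℝ, 0 ≤ p ∧ normSq L PΦ = ENNReal.ofReal p :=
    ⟨_, ENNReal.toReal_nonneg, (ENNReal.ofReal_toReal hpΦt).symm⟩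
  have hsumΨ : pΨ + rΨ = 1 := by
    rw [hpΨeq, hrΨeq, ← ENNReal.ofReal_add hpΨ0 hrΨ0, ← ENNReal.ofReal_one] at hPyΨ
    exact ((ENNReal.ofReal_eq_ofReal_iff zero_le_one (add_nonneg hpΨ0 hrΨ0)).1 hPyΨ).symm
  have hpΨ1 : pΨ ≤ 1 := by linarith
  have hpΦ1 : pΦ ≤ 1 := by
    have h : ENNReal.ofReal pΦ ≤ ENNReal.ofReal 1 := by
      rw [ENNReal.ofReal_one, ← hpΦeq]
      exact le_self_add.trans_eq hPyΦ.symm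
    exact (ENNReal.ofReal_le_ofReal_iff zero_le_one).1 h
  -- hypothesis 2 in real form: `1 - ε²/16 ≤ ‖PΨ‖²`, hence `‖Ψ - PΨ‖² ≤ ε²/16`
  have h2' : 1 - ε ^ 2 / 16 ≤ pΨ := by
    rw [hunscale Ψ.ψ, ← hPΨdef, hpΨeq, ← ENNReal.ofReal_mul hL6.le] at h2
    have h := (ENNReal.ofReal_le_ofReal_iff (mul_nonneg hL6.le hpΨ0)).1 h2
    nlinarith
  -- hypothesis 1 in real form: `1 - ε/2 ≤ a²`
  have h1' : 1 - ε / 2 ≤ ‖∫ X in cellN N L, conj (Ψ.ψ X) * Φ.ψ X‖ ^ 2 := by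
    rw [coe_nnnorm_sq_eq_ofReal] at h1
    exact (ENNReal.ofReal_le_ofReal_iff (sq_nonneg _)).1 h1
  -- Cauchy–Schwarz: `a² ≤ 1`, `b² ≤ ‖PΨ‖² ‖PΦ‖²`, `c² ≤ ‖Ψ - PΨ‖²`
  have ha1 : ‖∫ X in cellN N L, conj (Ψ.ψ X) * Φ.ψ X‖ ^ 2 ≤ 1 := by
    have h := nnnorm_inner_sq_le_normSq_mul (L := L) hΨc.contDiff.continuous.measurable
      hΦc.contDiff.continuous.measurable
    rw [show normSq L Ψ.ψ = 1 from Ψ.norm_eq, show normSq L Φ.ψ = 1 from Φ.norm_eq, mul_one,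
      coe_nnnorm_sq_eq_ofReal, ← ENNReal.ofReal_one] at h
    exact (ENNReal.ofReal_le_ofReal_iff zero_le_one).1 h
  have hb2 : ‖∫ X in cellN N L, conj (PΨ X) * PΦ X‖ ^ 2 ≤ pΨ * pΦ := by
    have h := nnnorm_inner_sq_le_normSq_mul (L := L) hPΨc.contDiff.continuous.measurable
      hPΦc.contDiff.continuous.measurable
    rw [hpΨeq, hpΦeq, ← ENNReal.ofReal_mul hpΨ0, coe_nnnorm_sq_eq_ofReal] at h
    exact (ENNReal.ofReal_le_ofReal_iff (mul_nonneg hpΨ0 hpΦ0)).1 h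
  have hc2 : ‖∫ X in cellN N L, conj (RΨ X) * Φ.ψ X‖ ^ 2 ≤ rΨ := by
    have h := nnnorm_inner_sq_le_normSq_mul (L := L) hRΨc.contDiff.continuous.measurable
      hΦc.contDiff.continuous.measurable
    rw [hrΨeq, show normSq L Φ.ψ = 1 from Φ.norm_eq, mul_one, coe_nnnorm_sq_eq_ofReal] at h
    exact (ENNReal.ofReal_le_ofReal_iff hrΨ0).1 h
  -- `⟨Ψ, Φ⟩ = ⟨PΨ, Φ⟩ + ⟨Ψ - PΨ, Φ⟩` and `⟨PΨ, Φ⟩ = ⟨PΨ, PΦ⟩`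
  have hsplit : ∫ X in cellN N L, conj (Ψ.ψ X) * Φ.ψ X =
      (∫ X in cellN N L, conj (PΨ X) * Φ.ψ X) + ∫ X in cellN N L, conj (RΨ X) * Φ.ψ X := by
    rw [← integral_add
      (integrableOn_cellN (f := fun X => conj (PΨ X) * Φ.ψ X)
        ((Complex.continuous_conj.comp hPΨc.contDiff.continuous).mul hΦc.contDiff.continuous) L)
      (integrableOn_cellN (f := fun X => conj (RΨ X) * Φ.ψ X)
        ((Complex.continuous_conj.comp hRΨc.contDiff.continuous).mul hΦc.contDiff.continuous) L)]
    refine integral_congr_ae (Eventually.of_forall fun X => ?_)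
    show conj (Ψ.ψ X) * Φ.ψ X = conj (PΨ X) * Φ.ψ X + conj (Ψ.ψ X - PΨ X) * Φ.ψ X
    rw [map_sub]
    ring
  have hinv : ∀ (X : Config N) (s : Space), PΨ (X + fun _ => s) = PΨ X := fun X s =>
    (hasTotalMomentum_zero_iff.1 hPΨ0) s X
  have hPΨinner : ∫ X in cellN N L, conj (PΨ X) * Φ.ψ X = ∫ X in cellN N L, conj (PΨ X) * PΦ X := by
    rw [hPΦdef]
    exact (inner_comProj_eq_of_invariant hL hPΨc.contDiff.continuous hPΨc.periodic hinv
      hΦc.contDiff.continuous hΦc.periodic).symm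
  have habc : ‖∫ X in cellN N L, conj (Ψ.ψ X) * Φ.ψ X‖ ≤
      ‖∫ X in cellN N L, conj (PΨ X) * PΦ X‖ + ‖∫ X in cellN N L, conj (RΨ X) * Φ.ψ X‖ := by
    rw [hsplit, hPΨinner]
    exact norm_add_le _ _
  -- the numbers
  set a : ℝ := ‖∫ X in cellN N L, conj (Ψ.ψ X) * Φ.ψ X‖ with ha
  set b : ℝ := ‖∫ X in cellN N L, conj (PΨ X) * PΦ X‖ with hb
  set c : ℝ := ‖∫ X in cellN N L, conj (RΨ X) * Φ.ψ X‖ with hc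
  have ha0 : 0 ≤ a := norm_nonneg _
  have hb0 : 0 ≤ b := norm_nonneg _
  have hc0 : 0 ≤ c := norm_nonneg _
  have ha1' : a ≤ 1 := (pow_le_one_iff_of_nonneg ha0 two_ne_zero).1 ha1
  have hcε : c ≤ ε / 4 := by
    have h : c ^ 2 ≤ (ε / 4) ^ 2 := by nlinarith
    exact (pow_le_pow_iff_left₀ hc0 (by positivity) two_ne_zero).1 h
  have hmain : 1 - ε ≤ pΦ := by
    have hba : a - ε / 4 ≤ b := by linarith
    have hpos : 0 ≤ a - ε / 4 := by nlinarith [mul_nonneg ha0 (sub_nonneg.2 ha1')]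
    have hb2' : (a - ε / 4) ^ 2 ≤ b ^ 2 := pow_le_pow_left₀ hpos hba 2
    have hbp : b ^ 2 ≤ pΦ := hb2.trans (mul_le_of_le_one_left hpΦ0 hpΨ1)
    nlinarith [mul_nonneg hε.le (sub_nonneg.2 ha1'), sq_nonneg ε, hbp, hb2', h1']
  have hfinal : ENNReal.ofReal (1 - ε) ≤ normSq L PΦ := by
    rw [hpΦeq]
    exact ENNReal.ofReal_le_ofReal hmain
  -- unscale
  calc ENNReal.ofReal ((1 - ε) * L ^ 6) = ENNReal.ofReal (L ^ 6) * ENNReal.ofReal (1 - ε) := by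
        rw [mul_comm, ENNReal.ofReal_mul hL6.le]
    _ ≤ ENNReal.ofReal (L ^ 6) * normSq L PΦ := mul_le_mul_right hfinal _
    _ = ∫⁻ X in cellN N L, (‖∫ t in cell L, Φ.ψ (X + fun _ => t)‖₊ : ℝ≥0∞) ^ 2 := by
        rw [hunscale Φ.ψ]

end Summit.AtomisticToContinuum.BoseEinsteinCondensation.Cruxes.CloudMomentumAtom.Birth

end
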